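import Literature.Probability.LatticeModels.IsoradialDual
import Literature.Probability.Percolation.RhombicTilingPlanarity
import HarnessLib

/-!
# The dual rhombic embedding of an isoradial rhombic tiling: isoradiality, tiling, angles

Proofs-only companion of `Literature.Probability.LatticeModels.IsoradialDual` (the dual graph
`G*` on the faces and the dual rhombic embedding `emb.dual`). Under `IsIsoradial` and the tiling
condition `IsRhombicTiling` of `emb : RhombicEmbedding G F`:

* `eq_of_leftFace_eq_of_rightFace_eq` — **a dart is determined by its ordered pair of faces**
  (two rhombi with the same dual diagonal have intersecting interiors, so they coincide;
  planarity input `openSegment_c_subset_interior_rhombus` of `RhombicTilingPlanarity`); hence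
  `primalDart_dualDart`, `dualDart_primalDart`, the bijection `dartEquivDual : G.Dart ≃ G*.Dart`,
  `primalDart_symm`, and the bijection of edge sets `edgeEquivDual : E(G) ≃ E(G*)` ("the dual
  edge `e*` crossing `e`");
* `isIsoradial_dual` — **`G*` is isoradial** (Grimmett–Manolescu 2014, §4.1: "It follows in
  particular that `G*` is isoradial"), with the same rhombi: `rhombus_dual`;
* `isRhombicTiling_dual` — the dual embedding satisfies the tiling condition;
* `cos_halfAngle_dual`, `halfAngle_dual` — the half-angle of a dual dart is `π/2 - ` the
  half-angle of the primal dart it crosses (the two diagonals of a rhombus with unit sides: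
  `cos² + cos² = 1`), i.e. `θ_{e*} = π - θ_e` in the convention of the paper (§2.2);
* `hasBoundedAngles_dual` — BAP(ε) passes to the dual (§2.2, display after (2.3): "`G*`
  satisfies BAP(ε) if and only if `G` satisfies BAP(ε)"; here the direction `G ⇒ G*`).

Not here (sequels): the square-grid property of the dual (tracks of `G` and `G*` are the same
sequences of rhombi, §4.2: "`𝒯(G) = 𝒯(G*)`"), the identification of the canonical measure of
`G*` with the law of the dual configuration (`p_e + p_{e*} = 1`, §2.2), connectivity and local
finiteness of `G*`.

## References

* G. R. Grimmett, I. Manolescu, *Bond percolation on isoradial graphs: criticality and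
  universality*, PTRF 159 (2014) 273–327, arXiv:1204.0505, §2.2 and §4.1.
-/

noncomputable section

namespace Literature.Probability.Percolation

open Complex Metric Set
open Literature.Probability.LatticeModels Literature.Probability.LatticeModels.RhombicEmbedding
  IsoradialCriticality

variable {V F : Type*} {G : SimpleGraph V} {emb : RhombicEmbedding G F}

/-! ### A dart is determined by its two faces -/

/-- The midpoint of the dual diagonal of a dart lies in the interior of its rhombus. [folklore] -/
theorem midpoint_c_mem_interior_rhombus (hiso : emb.IsIsoradial) (d : G.Dart) :
    (emb.c (emb.leftFace d) + emb.c (emb.rightFace d)) / 2 ∈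
      interior (emb.rhombus ⟨d.edge, d.edge_mem⟩) := by
  apply openSegment_c_subset_interior_rhombus hiso d
  refine ⟨1 / 2, 1 / 2, by norm_num, by norm_num, by norm_num, ?_⟩
  simp only [Complex.real_smul]
  push_cast
  ring

/-- **Two darts with the same left face and the same right face are equal**: their rhombi share
the midpoint of the common dual diagonal as an interior point, so by the tiling condition they
are the rhombus of one edge, and the orientation is fixed by the left face.
(Grimmett–Manolescu 2014, §4.1: a rhombus of `G^◇` is determined by its diagonal `e*`.)
[cite: GrimmettManolescu2014Isoradial, §4.1 (diamond graph and rhombic tiling)] -/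
theorem eq_of_leftFace_eq_of_rightFace_eq (hiso : emb.IsIsoradial) (hrh : emb.IsRhombicTiling)
    {d d' : G.Dart} (hl : emb.leftFace d = emb.leftFace d')
    (hr : emb.rightFace d = emb.rightFace d') : d = d' := by
  have hm := midpoint_c_mem_interior_rhombus hiso d
  have hm' := midpoint_c_mem_interior_rhombus hiso d'
  rw [← hl, ← hr] at hm'
  have he : (⟨d.edge, d.edge_mem⟩ : G.edgeSet) = ⟨d'.edge, d'.edge_mem⟩ := by
    by_contra hne
    exact Set.disjoint_left.1 (hrh.disjoint_interior hne) hm hm'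
  have he' : d.edge = d'.edge := congrArg Subtype.val he
  rcases (SimpleGraph.dart_edge_eq_iff d d').1 he' with h | h
  · exact h
  · exfalso
    apply hiso.c_leftFace_ne d'
    have h1 : emb.leftFace d = emb.rightFace d' := by rw [h, hiso.leftFace_symm]
    rw [← hl, h1]

/-- The primal dart of the dual dart of `d` is `d`. [folklore] -/
theorem primalDart_dualDart (hiso : emb.IsIsoradial) (hrh : emb.IsRhombicTiling) (d : G.Dart) :
    emb.primalDart (emb.dualDart hiso d) = d :=
  eq_of_leftFace_eq_of_rightFace_eq hiso hrh (emb.leftFace_primalDart hiso _)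
    (emb.rightFace_primalDart hiso _)

/-- The dual dart of the primal dart of `D` is `D`. [folklore] -/
theorem dualDart_primalDart (hiso : emb.IsIsoradial) (D : emb.dualGraph.Dart) :
    emb.dualDart hiso (emb.primalDart D) = D := by
  ext
  · exact emb.leftFace_primalDart hiso D
  · exact emb.rightFace_primalDart hiso D

/-- **Darts of `G` and of `G*` correspond** (each primal dart is crossed from left to right by
exactly one dual dart). (Grimmett–Manolescu 2014, §2.2/§4.1.) [folklore] -/
def dartEquivDual (hiso : emb.IsIsoradial) (hrh : emb.IsRhombicTiling) :
    G.Dart ≃ emb.dualGraph.Dart where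
  toFun := emb.dualDart hiso
  invFun := emb.primalDart
  left_inv := primalDart_dualDart hiso hrh
  right_inv := dualDart_primalDart hiso

/-- Reversing a dual dart reverses the primal dart it crosses. [folklore] -/
theorem primalDart_symm (hiso : emb.IsIsoradial) (hrh : emb.IsRhombicTiling)
    (D : emb.dualGraph.Dart) : emb.primalDart D.symm = (emb.primalDart D).symm := by
  apply eq_of_leftFace_eq_of_rightFace_eq hiso hrh
  · rw [emb.leftFace_primalDart hiso, hiso.leftFace_symm, emb.rightFace_primalDart hiso]
    rfl
  · have h := hiso.leftFace_symm (emb.primalDart D).symm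
    rw [SimpleGraph.Dart.symm_symm] at h
    rw [emb.rightFace_primalDart hiso, ← h, emb.leftFace_primalDart hiso]
    rfl

/-! ### `G*` is isoradial, with the same rhombi -/

/-- **The dual of an isoradial rhombic tiling is isoradial** (Grimmett–Manolescu 2014, §4.1:
"It follows in particular that `G*` is isoradial"): unit corner–centre distances are those of
the primal rhombi, left/right are exchanged consistently under reversal (`primalDart_symm`),
dual rhombi are non-degenerate (`z` injective), and the face centres are distinct
(`IsRhombicTiling.c_injective`). [cite: GrimmettManolescu2014Isoradial, §4.1 (G* is isoradial)] -/
theorem isIsoradial_dual (hiso : emb.IsIsoradial) (hrh : emb.IsRhombicTiling) :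
    emb.dual.IsIsoradial where
  norm_sub_eq_one D := by
    have hf : D.fst = emb.leftFace (emb.primalDart D) := (emb.leftFace_primalDart hiso D).symm
    have hg : D.snd = emb.rightFace (emb.primalDart D) := (emb.rightFace_primalDart hiso D).symm
    have h2 := (hiso.norm_sub_eq_one (emb.primalDart D)).2
    have h3 := (hiso.norm_sub_eq_one (emb.primalDart D).symm).1
    rw [hiso.leftFace_symm] at h3
    simp only [dual_z, dual_c, dual_leftFace]
    refine ⟨?_, ?_⟩
    · rw [hf, norm_sub_rev]; exact h2
    · rw [hg, norm_sub_rev]; exact h3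
  leftFace_symm D := by
    simp only [dual_leftFace, dual_rightFace, primalDart_symm hiso hrh]
    rfl
  c_leftFace_ne D := by
    simp only [dual_c, dual_leftFace, dual_rightFace]
    exact fun h => (emb.primalDart D).fst_ne_snd (hiso.z_injective h).symm
  z_injective := hrh.c_injective

/-- The dual edge crossing a primal edge, read off any dart over it, does not depend on the
orientation. [folklore] -/
theorem dualDart_edge_eq_of_edge_eq (hiso : emb.IsIsoradial) {d d' : G.Dart}
    (h : d.edge = d'.edge) : (emb.dualDart hiso d).edge = (emb.dualDart hiso d').edge := by
  rcases (SimpleGraph.dart_edge_eq_iff d d').1 h with rfl | rfl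
  · rfl
  · rw [emb.dualDart_symm hiso, SimpleGraph.Dart.edge_symm]

/-- The primal edge crossed by a dual edge, read off any dual dart over it, does not depend on
the orientation. [folklore] -/
theorem primalDart_edge_eq_of_edge_eq (hiso : emb.IsIsoradial) (hrh : emb.IsRhombicTiling)
    {D D' : emb.dualGraph.Dart} (h : D.edge = D'.edge) :
    (emb.primalDart D).edge = (emb.primalDart D').edge := by
  rcases (SimpleGraph.dart_edge_eq_iff D D').1 h with rfl | rfl
  · rfl
  · rw [primalDart_symm hiso hrh, SimpleGraph.Dart.edge_symm]

/-- **Edges of `G` and of `G*` correspond**: `e ↦ e*`, the dual edge crossing `e`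
(Grimmett–Manolescu 2014, §2.2: "Let `e* ∈ E*` be the dual edge crossing the primal edge
`e ∈ E`"). [cite: GrimmettManolescu2014Isoradial, §2.2 (the dual edge e*)] -/
def edgeEquivDual (hiso : emb.IsIsoradial) (hrh : emb.IsRhombicTiling) :
    G.edgeSet ≃ emb.dualGraph.edgeSet where
  toFun e := ⟨(emb.dualDart hiso (refDart e)).edge, SimpleGraph.Dart.edge_mem _⟩
  invFun e' := ⟨(emb.primalDart (refDart e')).edge, SimpleGraph.Dart.edge_mem _⟩
  left_inv e := by
    apply Subtype.ext
    have h1 : (refDart (⟨(emb.dualDart hiso (refDart e)).edge, SimpleGraph.Dart.edge_mem _⟩ :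
        emb.dualGraph.edgeSet)).edge = (emb.dualDart hiso (refDart e)).edge := refDart_edge _
    change (emb.primalDart _).edge = (e : Sym2 V)
    rw [primalDart_edge_eq_of_edge_eq hiso hrh h1, primalDart_dualDart hiso hrh, refDart_edge]
  right_inv e' := by
    apply Subtype.ext
    have h1 : (refDart (⟨(emb.primalDart (refDart e')).edge, SimpleGraph.Dart.edge_mem _⟩ :
        G.edgeSet)).edge = (emb.primalDart (refDart e')).edge := refDart_edge _
    change (emb.dualDart hiso _).edge = (e' : Sym2 F)
    rw [dualDart_edge_eq_of_edge_eq hiso h1, dualDart_primalDart hiso, refDart_edge]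

/-- The dual edge of (the edge of) a dart. [folklore] -/
theorem edgeEquivDual_apply_dart (hiso : emb.IsIsoradial) (hrh : emb.IsRhombicTiling)
    (d : G.Dart) :
    (edgeEquivDual hiso hrh ⟨d.edge, d.edge_mem⟩ : Sym2 F) = (emb.dualDart hiso d).edge :=
  dualDart_edge_eq_of_edge_eq hiso (refDart_edge _)

/-- The primal edge of (the edge of) a dual dart. [folklore] -/
theorem edgeEquivDual_symm_apply_dart (hiso : emb.IsIsoradial) (hrh : emb.IsRhombicTiling)
    (D : emb.dualGraph.Dart) :
    ((edgeEquivDual hiso hrh).symm ⟨D.edge, D.edge_mem⟩ : Sym2 V) = (emb.primalDart D).edge :=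
  primalDart_edge_eq_of_edge_eq hiso hrh (refDart_edge _)

/-- **The rhombus of a dual edge is the rhombus of the primal edge it crosses** (the same four
corners, the two diagonals exchanged). (Grimmett–Manolescu 2014, §4.1: "The pair `e`, `e*` are
diagonals of the same rhombus of `G^◇`".) [cite: GrimmettManolescu2014Isoradial, §4.1 (e and e* are the diagonals of one rhombus)] -/
theorem rhombus_dual (hiso : emb.IsIsoradial) (hrh : emb.IsRhombicTiling)
    (e' : emb.dualGraph.edgeSet) :
    emb.dual.rhombus e' = emb.rhombus ((edgeEquivDual hiso hrh).symm e') := by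
  set D := refDart e' with hD
  have h1 : emb.dual.rhombus e' = convexHull ℝ {emb.c D.fst, emb.z (emb.primalDart D).snd,
      emb.c D.snd, emb.z (emb.primalDart D).fst} := rfl
  have h2 : (edgeEquivDual hiso hrh).symm e' = ⟨(emb.primalDart D).edge, SimpleGraph.Dart.edge_mem _⟩ :=
    rfl
  rw [h1, h2, rhombus_dart_eq hiso (emb.primalDart D), emb.leftFace_primalDart hiso,
    emb.rightFace_primalDart hiso]
  congr 1
  ext w
  simp only [mem_insert_iff, mem_singleton_iff]
  tauto

/-- **The dual embedding satisfies the tiling condition** (same family of rhombi, reindexed by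
`edgeEquivDual`; the "faces" of `G*` are the vertices, at the injective positions `z`).
[cite: GrimmettManolescu2014Isoradial, §4.1 (G and G* from the diamond graph)] -/
theorem isRhombicTiling_dual (hiso : emb.IsIsoradial) (hrh : emb.IsRhombicTiling) :
    emb.dual.IsRhombicTiling where
  disjoint_interior e₁ e₂ hne := by
    change Disjoint (interior (emb.dual.rhombus e₁)) (interior (emb.dual.rhombus e₂))
    rw [rhombus_dual hiso hrh, rhombus_dual hiso hrh]
    exact hrh.disjoint_interior fun h => hne ((edgeEquivDual hiso hrh).symm.injective h)
  iUnion_rhombus := by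
    rw [Set.eq_univ_iff_forall]
    intro w
    have hw : w ∈ ⋃ e : G.edgeSet, emb.rhombus e := by rw [hrh.iUnion_rhombus]; trivial
    obtain ⟨e, he⟩ := Set.mem_iUnion.1 hw
    refine Set.mem_iUnion.2 ⟨edgeEquivDual hiso hrh e, ?_⟩
    rwa [rhombus_dual hiso hrh, Equiv.symm_apply_apply]
  c_injective := hiso.z_injective

/-! ### Angles of the dual -/

/-- The half-angle of a dart of an isoradial embedding lies in `[0, π/2]` (its cosine,
`‖z x - z y‖ / 2`, is nonnegative). [folklore] -/
theorem halfAngle_mem_Icc (hiso : emb.IsIsoradial) (d : G.Dart) :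
    emb.halfAngle d ∈ Icc 0 (Real.pi / 2) := by
  have h0 : 0 ≤ emb.halfAngle d := abs_nonneg _
  have hpi : emb.halfAngle d ≤ Real.pi := by
    unfold RhombicEmbedding.halfAngle
    have harg := Complex.neg_pi_lt_arg
      ((emb.c (emb.leftFace d) - emb.z d.fst) / (emb.z d.snd - emb.z d.fst))
    exact abs_le.2 ⟨harg.le, Complex.arg_le_pi _⟩
  refine ⟨h0, ?_⟩
  by_contra hlt
  push Not at hlt
  have hneg : Real.cos (emb.halfAngle d) < 0 :=
    Real.cos_neg_of_pi_div_two_lt_of_lt hlt (by linarith)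
  have hcos := cos_halfAngle hiso d
  linarith [norm_nonneg (emb.z d.fst - emb.z d.snd)]

/-- **Cosine of the dual half-angle**: `cos (halfAngle* D) = ‖c f - c g‖ / 2 = sin (halfAngle d)`
for the primal dart `d` crossed by `D = (f → g)` (the two half-diagonals `a`, `p` of a rhombus
with unit sides satisfy `‖a‖² + ‖p‖² = 1`). (Grimmett–Manolescu 2014, §2.2: `θ_{e*} = π - θ_e`.)
[cite: GrimmettManolescu2014Isoradial, §2.2 (θ_{e*} = π − θ_e)] -/
theorem cos_halfAngle_dual (hiso : emb.IsIsoradial) (hrh : emb.IsRhombicTiling)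
    (D : emb.dualGraph.Dart) :
    Real.cos (emb.dual.halfAngle D) = Real.sin (emb.halfAngle (emb.primalDart D)) := by
  set d := emb.primalDart D with hd
  have hcos' := cos_halfAngle (isIsoradial_dual hiso hrh) D
  simp only [dual_z] at hcos'
  have hf : D.fst = emb.leftFace d := (emb.leftFace_primalDart hiso D).symm
  have hg : D.snd = emb.rightFace d := (emb.rightFace_primalDart hiso D).symm
  rw [hf, hg] at hcos'
  have hcos := cos_halfAngle hiso d
  obtain ⟨h1, h2⟩ := hiso.norm_sub_eq_one d
  obtain ⟨hn, -⟩ := rhombus_halfDiag (hiso.c_leftFace_add_c_rightFace d) h1 h2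
  rw [normSq_eq_norm_sq, normSq_eq_norm_sq, norm_div, norm_div, Complex.norm_two] at hn
  -- `cos θ* ≥ 0`, `sin θ ≥ 0`, and `cos² θ* = 1 - cos² θ = sin² θ`
  have hθ := halfAngle_mem_Icc hiso d
  have hsin : 0 ≤ Real.sin (emb.halfAngle d) :=
    Real.sin_nonneg_of_nonneg_of_le_pi hθ.1 (hθ.2.trans (by linarith [Real.pi_pos]))
  have hcos0 : 0 ≤ Real.cos (emb.dual.halfAngle D) := by
    rw [hcos']; positivity
  have hsq : Real.cos (emb.dual.halfAngle D) ^ 2 = Real.sin (emb.halfAngle d) ^ 2 := by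
    rw [Real.sin_sq, hcos', hcos]
    linarith
  exact (sq_eq_sq₀ hcos0 hsin).1 hsq |>.trans (by rw [hd])

/-- **The half-angle of a dual dart is complementary to that of the primal dart it crosses**:
`halfAngle* D = π/2 - halfAngle d` (in the paper's convention `θ_{e*} = π - θ_e`, §2.2).
[cite: GrimmettManolescu2014Isoradial, §2.2 (θ_{e*} = π − θ_e)] -/
theorem halfAngle_dual (hiso : emb.IsIsoradial) (hrh : emb.IsRhombicTiling)
    (D : emb.dualGraph.Dart) :
    emb.dual.halfAngle D = Real.pi / 2 - emb.halfAngle (emb.primalDart D) := by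
  have h1 := halfAngle_mem_Icc (isIsoradial_dual hiso hrh) D
  have h2 := halfAngle_mem_Icc hiso (emb.primalDart D)
  apply Real.injOn_cos ⟨h1.1, h1.2.trans (by linarith [Real.pi_pos])⟩
    ⟨by linarith [h2.2], by linarith [h2.1, Real.pi_pos]⟩
  rw [cos_halfAngle_dual hiso hrh, Real.cos_pi_div_two_sub]

/-- **BAP(ε) passes to the dual** (Grimmett–Manolescu 2014, §2.2, after (2.3): "`G*` satisfies
BAP(ε) if and only if `G` satisfies BAP(ε)"; the tree's `HasBoundedAngles ε` — half-angles in
`[ε, π/2 - ε]` — is symmetric under `θ ↦ π/2 - θ`). [cite: GrimmettManolescu2014Isoradial, §2.2 (BAP for G*)] -/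
theorem hasBoundedAngles_dual (hiso : emb.IsIsoradial) (hrh : emb.IsRhombicTiling) {ε : ℝ}
    (h : emb.HasBoundedAngles ε) : emb.dual.HasBoundedAngles ε := fun D => by
  obtain ⟨hlo, hhi⟩ := h (emb.primalDart D)
  rw [halfAngle_dual hiso hrh]
  constructor <;> linarith

end Literature.Probability.Percolation

end
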